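import Summits.CriticalPhenomena.SAWScalingLimit.Theorems.SAWDevelopingMapObservableToSLERestrictionIdentifies
import Summits.CriticalPhenomena.SAWScalingLimit.Theorems.SAWDevelopingMapObservableToSLEChordalCarrier
import HarnessLib

/-!
# Crux `SAWDefectDecoherence.ObservableToSLER` (stmt-CriticalPhenomena-14005), line
`bridge-gate-renewal` (r7), stub 5a3 `stub_twoPieceAdmIdentification`: the LSW closing for an
ABSTRACT law (carrier + restriction sandwich ⟹ SLE(8/3)), and the carrier from the upper sandwich

Landing target:
`Summits/CriticalPhenomena/SAWScalingLimit/Theorems/SAWDefectDecoherenceObservableToSLERTwoPieceAdmIdentificationClosing.lean`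
(`--supports stmt-CriticalPhenomena-14005`).

Port of crux 10472's landed LSW closing (`FloorRatio.stub_restrictionIdentifies`, p85931, and
`FloorRatio.measure_avoid_eq_of_squeeze`, p77266) in which the lattice origin of the law `μ` is
abstracted away: the only two facts about `μ` used there — that `μ` is carried by the chordal
carrier of `(D; a, b)` and THE RESTRICTION SANDWICH
`μ{trace ∩ φ̂(A) = ∅} ≤ Φ'_A(0)^{5/8} ≤ μ{trace ⊆ cl D'}` for every Jordan hull subdomain
`D' = φ(ℍ ∖ A)` with restriction data `(Φ_A, Φ'_A(0))` — become the hypotheses.  This is the form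
consumed by the Duminil-Copin–Smirnov laws on admissible mid-edge families (stub 5a3), whose
sandwich is proved from the two-piece admissible restriction limit in the sibling files.

* `measure_avoid_eq_of_sandwich` — the avoidance probability of a squeezed `*`-hull is that of the
  SLE(8/3) law (outer continuity of avoidance + the sandwich);
* `isSLELaw_of_carrier_of_sandwich` — **a probability law on curve classes carried by the chordal
  carrier and satisfying the restriction sandwich over all hull subdomains is the chordal SLE(8/3)
  law** (plus-side separation `injOn_missCode_plusHulls`, `CurveClass.Measure.ext_of_missCode_injOn`,
  [LSW] Lemma 2.1 hulls `stub_restrictionIdentifies_plusApprox`, Thm 6.1 `exists_sleLaw_through`);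
* the CARRIER from the upper half of the sandwich (port of the boundary-avoidance half of
  `FloorRatio.stub_chordalCarrier_reduction` p76439 / `…_collars` p76478 with the lattice law
  abstracted away): `Φ'_A(0)^{5/8} ≤ μ{trace ⊆ cl D'}` over the hull subdomains gives avoidance of
  every boundary piece through thin half-ellipse collar hulls (`ae_disjoint_range_of_upper`,
  `exists_collarFamily_of_upper`, `collars_of_upper`), whence `ae_mem_chordalCarrier_of_upper`
  from a.e. simplicity, endpoints and confinement;
* registry forms `stub_twoPieceAdmIdentification_closing`, `stub_twoPieceAdmIdentification_carrier`.
-/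

noncomputable section

open scoped BigOperators Topology NNReal ENNReal Classical
open Filter Set MeasureTheory Metric Complex
open Literature.Probability.RandomPlanarGeometry
open UpperHalfPlane (upperHalfPlaneSet)
open Literature.Topology.PlaneTopology (JordanCurveTheorem_holds)

namespace Summit.CriticalPhenomena.SAWScalingLimit.Theorems.ObservableToSLER.TwoPiece

open Summit.CriticalPhenomena.SAWScalingLimit.Theorems.ObservableToSLE.FloorRatio

/-- **The avoidance probability of a squeezed `*`-hull under the sandwich.**  Let `μ` be a law on
curve classes carried by the chordal carrier of `(D; a, b)` which satisfies the restriction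
sandwich `μ{trace ∩ φ̂(A) = ∅} ≤ Φ'_A(0)^{5/8} ≤ μ{trace ⊆ cl D'}` for every hull subdomain `D'`
(`A` its pulled-back hull), let `ν` be a law carried by the chordal carrier with
`ν{trace ∩ φ̂(A) = ∅} = Φ'_A(0)^{5/8}` for all `*`-hulls `A`, and let the `*`-hull `B` be squeezed by
the pull-backs `A_k ↓` of hull subdomains `D_k` (`B ∩ ℍ ⊆ int A_k`, `(⋂ A_k) ∩ ℍ ⊆ B`).  Then
`μ{trace ∩ φ̂(B) = ∅} = ν{trace ∩ φ̂(B) = ∅}`: both are `supₖ` of the avoidance probabilities of the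
`A_k` (`measure_avoid_eq_iSup_of_squeeze`).
[cite: LawlerSchrammWerner2003Restriction, Thm. 6.1 (p. 23) and Lemma 3.2 (p. 10), transposed] -/
theorem measure_avoid_eq_of_sandwich {D : DobrushinDomain} {μ : Measure (CurveClass ℂ)}
    (hcar : ∀ᵐ c ∂μ, c ∈ chordalCarrier D)
    (hsand : ∀ (D' : DobrushinDomain) (φ : ConformalEquiv upperHalfPlaneSet D.carrier)
      (Φ : ConformalEquiv (upperHalfPlaneSet \ φ.pullbackHull D') upperHalfPlaneSet) (d : ℝ),
      D.IsHullSubdomain D' → D.IsChordalUniformizing φ →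
      IsRestrictionMap (φ.pullbackHull D') Φ → HasRestrictionDeriv (φ.pullbackHull D') Φ d →
      μ (CurveClass.rangeSubset (φ.boundaryExtension '' φ.pullbackHull D')ᶜ) ≤
          ENNReal.ofReal (d ^ ((5 : ℝ) / 8)) ∧
        ENNReal.ofReal (d ^ ((5 : ℝ) / 8)) ≤ μ (CurveClass.rangeSubset (closure D'.carrier)))
    {φ : ConformalEquiv upperHalfPlaneSet D.carrier} (hφ : D.IsChordalUniformizing φ)
    {ν : Measure (CurveClass ℂ)} (hνcar : ∀ᵐ c ∂ν, c ∈ chordalCarrier D)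
    (hνav : ∀ (A : Set ℂ) (Φ : ConformalEquiv (upperHalfPlaneSet \ A) upperHalfPlaneSet) (d : ℝ),
      IsStarHull A → IsRestrictionMap A Φ → HasRestrictionDeriv A Φ d →
      ν (CurveClass.rangeSubset (φ.boundaryExtension '' A)ᶜ) = ENNReal.ofReal (d ^ ((5 : ℝ) / 8)))
    {B : Set ℂ} (hB : IsStarHull B) {Dk : ℕ → DobrushinDomain}
    (hDk : ∀ k, D.IsHullSubdomain (Dk k)) (hanti : Antitone fun k => φ.pullbackHull (Dk k))
    (hint : ∀ k, B ∩ upperHalfPlaneSet ⊆ interior (φ.pullbackHull (Dk k)))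
    (hlim : (⋂ k, φ.pullbackHull (Dk k)) ∩ upperHalfPlaneSet ⊆ B) :
    μ (CurveClass.rangeSubset (φ.boundaryExtension '' B)ᶜ) =
      ν (CurveClass.rangeSubset (φ.boundaryExtension '' B)ᶜ) := by
  classical
  have hsc : ∀ D : JordanDomain, D.isSimplyConnected := JordanDomain.isSimplyConnected_holds
  have hC : JordanDomain.exists_continuousOn_extension := JordanDomain.exists_continuousOn_extension_holds
  have hJarc : Literature.Topology.PlaneTopology.JordanArcSeparation :=
    Literature.Topology.PlaneTopology.JordanArcSeparation_holds
  have hexΦ : IsStarHull.existsUnique_isRestrictionMap := IsStarHull.existsUnique_isRestrictionMap_holds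
  have hex : IsStarHull.exists_hasRestrictionDeriv := IsStarHull.exists_hasRestrictionDeriv_holds
  -- the squeezing hulls, their restriction maps and derivatives
  set A : ℕ → Set ℂ := fun k => φ.pullbackHull (Dk k) with hAdef
  have hA : ∀ k, IsStarHull (A k) := fun k => IsStarHull.pullbackHull hsc hφ (hDk k)
  choose Φk hΦk _ using fun k => hexΦ (hA k)
  choose dk _ _ hdk using fun k => hex (hA k) (hΦk k)
  have hsub : ∀ k, B ∩ upperHalfPlaneSet ⊆ A k := fun k => (hint k).trans interior_subset
  -- avoidance probabilities of `B` are suprema of those of the `A k`, for every carried law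
  have hsup : ∀ (ρ : Measure (CurveClass ℂ)), (∀ᵐ c ∂ρ, c ∈ chordalCarrier D) →
      ρ (CurveClass.rangeSubset (φ.boundaryExtension '' B)ᶜ) =
        ⨆ k, ρ (CurveClass.rangeSubset (φ.boundaryExtension '' A k)ᶜ) := by
    intro ρ hρ
    rw [← ChordalFamily.pullbackLaw_avoid (hJarc := hJarc) (hC := hC) (hφ := hφ) (fun _ => ρ) hρ hB,
      measure_avoid_eq_iSup_of_squeeze _ hanti (fun k => (hA k).1.isClosed) (hA 0).1.isCompact
        (hA 0).2 hsub hlim]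
    exact iSup_congr fun k =>
      ChordalFamily.pullbackLaw_avoid (hJarc := hJarc) (hC := hC) (hφ := hφ) (fun _ => ρ) hρ (hA k)
  -- `μ`: sandwich for each `k`
  have hup : ∀ k, μ (CurveClass.rangeSubset (φ.boundaryExtension '' A k)ᶜ) ≤
      ENNReal.ofReal (dk k ^ ((5 : ℝ) / 8)) ∧
      ENNReal.ofReal (dk k ^ ((5 : ℝ) / 8)) ≤ μ (CurveClass.rangeSubset (closure (Dk k).carrier)) :=
    fun k => hsand (Dk k) φ (Φk k) (dk k) (hDk k) hφ (hΦk k) (hdk k)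
  have hlow : ∀ k, μ (CurveClass.rangeSubset (closure (Dk k).carrier)) ≤
      μ (CurveClass.rangeSubset (φ.boundaryExtension '' B)ᶜ) := fun k => by
    refine measure_mono_ae ?_
    filter_upwards [hcar] with c hc hV
    exact (disjoint_pullbackTrace_iff_mem_rangeSubset hC hφ hc hB.1.subset_closure hB.2).1
      (disjoint_pullbackTrace_of_rangeSubset_closure (hDk k) (hint k) hV)
  have hμeq : μ (CurveClass.rangeSubset (φ.boundaryExtension '' B)ᶜ) =
      ⨆ k, ENNReal.ofReal (dk k ^ ((5 : ℝ) / 8)) := by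
    refine le_antisymm ?_ (iSup_le fun k => (hup k).2.trans (hlow k))
    rw [hsup μ hcar]
    exact iSup_mono fun k => (hup k).1
  -- `ν`: exact values
  have hνeq : ν (CurveClass.rangeSubset (φ.boundaryExtension '' B)ᶜ) =
      ⨆ k, ENNReal.ofReal (dk k ^ ((5 : ℝ) / 8)) := by
    rw [hsup ν hνcar]
    exact iSup_congr fun k => hνav (A k) (Φk k) (dk k) (hA k) (hΦk k) (hdk k)
  rw [hμeq, hνeq]

/-- **THE LSW CLOSING FOR AN ABSTRACT LAW.**  A probability law `μ` on curve classes which is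
carried by the chordal carrier of the Dobrushin domain `(D; a, b)` (simple classes from `a` to
`b` with trace in `D ∪ {a, b}`) and satisfies the restriction sandwich
`μ{trace ∩ φ̂(A) = ∅} ≤ Φ'_A(0)^{5/8} ≤ μ{trace ⊆ cl D'}` for every Jordan hull subdomain
`D' = φ(ℍ ∖ A)` of `D` (every chordal uniformizing map `φ`, restriction data `(Φ_A, Φ'_A(0))`) IS
the chordal SLE(8/3) law of `D`.  Proof (port of `FloorRatio.stub_restrictionIdentifies`): transfer
theorem `CurveClass.Measure.ext_of_missCode_injOn` against the SLE(8/3) law `ν` through `φ`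
(`exists_sleLaw_through`) with the countable test family of images of dyadic `+`-hulls, whose
avoidance code is injective on the chordal carrier (`injOn_missCode_plusHulls`); finite unions
have fills that swallow `0` or are `+`-hulls squeezed by [LSW] Lemma 2.1 hulls of hull subdomains
(`stub_restrictionIdentifies_plusApprox`), where `μ` and `ν` agree by
`measure_avoid_eq_of_sandwich`.
[cite: LawlerSchrammWerner2003Restriction, Lemma 3.2 (p. 10), Lemma 2.1 (p. 8), Thm. 6.1 (p. 23), §8.1 (p. 31), transposed] -/
theorem isSLELaw_of_carrier_of_sandwich {D : DobrushinDomain} {μ : Measure (CurveClass ℂ)}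
    [IsProbabilityMeasure μ] (hcar : ∀ᵐ c ∂μ, c ∈ chordalCarrier D)
    (hsand : ∀ (D' : DobrushinDomain) (φ : ConformalEquiv upperHalfPlaneSet D.carrier)
      (Φ : ConformalEquiv (upperHalfPlaneSet \ φ.pullbackHull D') upperHalfPlaneSet) (d : ℝ),
      D.IsHullSubdomain D' → D.IsChordalUniformizing φ →
      IsRestrictionMap (φ.pullbackHull D') Φ → HasRestrictionDeriv (φ.pullbackHull D') Φ d →
      μ (CurveClass.rangeSubset (φ.boundaryExtension '' φ.pullbackHull D')ᶜ) ≤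
          ENNReal.ofReal (d ^ ((5 : ℝ) / 8)) ∧
        ENNReal.ofReal (d ^ ((5 : ℝ) / 8)) ≤ μ (CurveClass.rangeSubset (closure D'.carrier))) :
    IsSLELaw ((8 : ℝ≥0) / 3) D μ := by
  classical
  have hC : JordanDomain.exists_continuousOn_extension := JordanDomain.exists_continuousOn_extension_holds
  have hJarc : Literature.Topology.PlaneTopology.JordanArcSeparation :=
    Literature.Topology.PlaneTopology.JordanArcSeparation_holds
  have hFa : isSimplyConnected_of_isConnected_compl := isSimplyConnected_of_isConnected_compl_holds
  obtain ⟨φ, hφ⟩ := MarkedDomain.exists_isChordalUniformizing_holds D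
  obtain ⟨ν, hνsle, hνp, hνcar, hνav⟩ := exists_sleLaw_through hφ
  haveI := hνp
  suffices hμν : μ = ν by
    obtain ⟨Γ, hΓ, hν⟩ := hνsle
    exact ⟨Γ, hΓ, hμν.trans hν⟩
  -- the countable family of dyadic `+`-hulls
  set A : ℕ × Finset (ℤ × ℤ) → Set ℂ := fun p =>
    if IsPlusHull (hpFill (dyadicUnion p.1 p.2)) then hpFill (dyadicUnion p.1 p.2) else ∅ with hAdef
  set C : ℕ → Set ℂ := fun k => (Encodable.decode (α := ℕ × Finset (ℤ × ℤ)) k).elim ∅ A with hCdef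
  have hAspec : ∀ p, A p = ∅ ∨ IsPlusHull (A p) := fun p => by
    by_cases h : IsPlusHull (hpFill (dyadicUnion p.1 p.2))
    · right; rw [hAdef]; simp only [if_pos h]; exact h
    · left; rw [hAdef]; simp only [if_neg h]
  have hCspec : ∀ k, C k = ∅ ∨ IsPlusHull (C k) := fun k => by
    change (Encodable.decode (α := ℕ × Finset (ℤ × ℤ)) k).elim ∅ A = ∅ ∨
      IsPlusHull ((Encodable.decode (α := ℕ × Finset (ℤ × ℤ)) k).elim ∅ A)
    cases Encodable.decode (α := ℕ × Finset (ℤ × ℤ)) k with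
    | none => exact Or.inl rfl
    | some p => exact hAspec p
  have hrich : ∀ (n : ℕ) (F : Finset (ℤ × ℤ)), IsPlusHull (hpFill (dyadicUnion n F)) →
      ∃ k, C k = hpFill (dyadicUnion n F) := fun n F h => by
    refine ⟨Encodable.encode (n, F), ?_⟩
    change (Encodable.decode (α := ℕ × Finset (ℤ × ℤ)) (Encodable.encode (n, F))).elim ∅ A = _
    rw [Encodable.encodek]
    change A (n, F) = _
    rw [hAdef]
    exact if_pos h
  have hCclosed : ∀ k, IsClosed (φ.boundaryExtension '' C k) := fun k => by
    rcases hCspec k with h | h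
    · rw [h, image_empty]; exact isClosed_empty
    · exact (MarkedDomain.isCompact_image_boundaryExtension hC h.1.1.subset_closure
        h.1.1.isCompact).isClosed
  refine CurveClass.Measure.ext_of_missCode_injOn hCclosed measurableSet_chordalCarrier
    (injOn_missCode_plusHulls hφ hrich) hcar hνcar fun s => ?_
  obtain ⟨hanch, hcpt, hcl, h0⟩ := biUnion_plusHull hCspec s
  have himage : (⋃ n ∈ s, φ.boundaryExtension '' C n) = φ.boundaryExtension '' ⋃ n ∈ s, C n := by
    simp only [image_iUnion]
  rw [himage]
  set T : Set ℂ := ⋃ n ∈ s, C n with hT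
  have hTc : IsClosed T := hcpt.isClosed
  have hTb : Bornology.IsBounded T := hcpt.isBounded
  rcases hanch with hempty | ⟨hanchT, hposT⟩
  · rw [hempty, rangeSubset_compl_image_empty, measure_univ, measure_univ]
  by_cases hfill : (0 : ℂ) ∈ hpFill T
  · have h1 := measure_rangeSubset_compl_image_eq_zero hC hφ (fun _ => μ) hcar hTc hcl h0 hfill
    have h2 := measure_rangeSubset_compl_image_eq_zero hC hφ (fun _ => ν) hνcar hTc hcl h0 hfill
    exact h1.trans h2.symm
  have hstar : IsStarHull (hpFill T) := isStarHull_hpFill hFa hTc hTb hanchT.2 hfill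
  have h1 := measure_rangeSubset_compl_image_eq hJarc hC hφ (fun _ => μ) hcar hTc hTb hcl h0 hstar
  have h1' := ChordalFamily.pullbackLaw_avoid (hJarc := hJarc) (hC := hC) (hφ := hφ) (fun _ => μ)
    hcar hstar
  have h2 := measure_rangeSubset_compl_image_eq hJarc hC hφ (fun _ => ν) hνcar hTc hTb hcl h0 hstar
  have h2' := ChordalFamily.pullbackLaw_avoid (hJarc := hJarc) (hC := hC) (hφ := hφ) (fun _ => ν)
    hνcar hstar
  refine h1.trans (h1'.trans (Eq.trans ?_ (h2.trans h2').symm))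
  rcases (hpFill T).eq_empty_or_nonempty with hem | hne
  · rw [hem, rangeSubset_compl_image_empty, measure_univ, measure_univ]
  have hplus : IsPlusHull (hpFill T) := isPlusHull_hpFill_of_pos hTc hposT hstar
  obtain ⟨Dk, hDk, hanti, hint, hlim⟩ :=
    stub_restrictionIdentifies_plusApprox D φ (hpFill T) hφ hplus hne
  exact measure_avoid_eq_of_sandwich hcar hsand hφ hνcar hνav hstar hDk hanti hint hlim

/-! ### The chordal carrier from the upper half of the sandwich -/

section Carrier

variable {D : DobrushinDomain} {μ : Measure (CurveClass ℂ)}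

/-- **Boundary avoidance from a collar family (abstract law).**  If a closed `Z ⊆ ℂ` is avoided by
the closures of sets `Ω'_j` and `p_j ≤ μ{trace ⊆ cl Ω'_j}` with `p_j → 1`, then `μ`-a.e. trace is
disjoint from `Z`. [cite: LawlerSchrammWerner2003Restriction, Lemma 3.2 (avoidance probabilities), transposed] -/
theorem ae_disjoint_range_of_upper [IsProbabilityMeasure μ] {Z : Set ℂ} (hZ : IsClosed Z)
    {Ω' : ℕ → Set ℂ} {p : ℕ → ℝ}
    (hlow : ∀ j, p j ≤ μ.real (CurveClass.rangeSubset (closure (Ω' j))))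
    (hp : Tendsto p atTop (𝓝 1)) (hΩZ : ∀ j, Disjoint (closure (Ω' j)) Z) :
    ∀ᵐ c ∂μ, Disjoint c.range Z := by
  have hsub : ∀ j, CurveClass.rangeSubset (closure (Ω' j)) ⊆ CurveClass.rangeSubset (E := ℂ) Zᶜ :=
    fun j c hc ↦ (show c.range ⊆ closure (Ω' j) from hc).trans (hΩZ j).subset_compl_right
  have h1 : (1 : ℝ) ≤ μ.real (CurveClass.rangeSubset Zᶜ) :=
    le_of_tendsto' hp fun j ↦ (hlow j).trans (measureReal_mono (hsub j))
  filter_upwards [ae_mem_of_one_le_measureReal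
    (CurveClass.measurableSet_rangeSubset_of_isOpen hZ.isOpen_compl) h1] with c hc
  exact disjoint_left.2 fun x hx hxZ ↦ hc hx hxZ

/-- **A collar family from collar data and the upper sandwich.**  Given
`Φ'_A(0)^{5/8} ≤ μ{trace ⊆ cl D'}` for every hull subdomain with restriction data, collar data for
`K ⊆ cl ℍ` with derivative numbers `d_j → 1` yield subdomains `Ω'_j` with `cl Ω'_j ∩ φ̂(K) = ∅` and
`d_j^{5/8} ≤ μ{trace ⊆ cl Ω'_j}`, `d_j^{5/8} → 1`.
[cite: LawlerSchrammWerner2003Restriction, Lemma 3.2 and Thm. 6.1 (transposed)] -/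
theorem exists_collarFamily_of_upper [IsFiniteMeasure μ]
    {φ : ConformalEquiv upperHalfPlaneSet D.carrier} {Ψ : ℂ → ℂ}
    (hφ : D.IsChordalUniformizing φ) (h : JordanDomain.IsDiscExtension D.toJordanDomain φ Ψ)
    (H : ∀ (D' : DobrushinDomain) (φ : ConformalEquiv upperHalfPlaneSet D.carrier)
      (Φ : ConformalEquiv (upperHalfPlaneSet \ φ.pullbackHull D') upperHalfPlaneSet) (d : ℝ),
      D.IsHullSubdomain D' → D.IsChordalUniformizing φ →
      IsRestrictionMap (φ.pullbackHull D') Φ → HasRestrictionDeriv (φ.pullbackHull D') Φ d →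
      ENNReal.ofReal (d ^ ((5 : ℝ) / 8)) ≤ μ (CurveClass.rangeSubset (closure D'.carrier)))
    {K : Set ℂ} (hKim : ∀ z ∈ K, 0 ≤ z.im) {d : ℕ → ℝ} (hd : Tendsto d atTop (𝓝 1))
    (hdata : ∀ j : ℕ, ∃ (J N : Set ℂ)
      (Φ : ConformalEquiv (upperHalfPlaneSet \ J) upperHalfPlaneSet),
      IsArcHull J ∧ (0 : ℂ) ∉ J ∧ IsRestrictionMap J Φ ∧ HasRestrictionDeriv J Φ (d j) ∧
      IsOpen N ∧ (∀ z ∈ N, 0 ≤ z.im → z ∈ J) ∧ K ⊆ N) :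
    ∃ (Ω' : ℕ → Set ℂ) (p : ℕ → ℝ), Tendsto p atTop (𝓝 1) ∧
      (∀ j, Disjoint (closure (Ω' j)) (φ.boundaryExtension '' K)) ∧
      ∀ j, p j ≤ μ.real (CurveClass.rangeSubset (closure (Ω' j))) := by
  have key : ∀ j : ℕ, ∃ D' : DobrushinDomain,
      Disjoint (closure D'.carrier) (φ.boundaryExtension '' K) ∧
      d j ^ ((5 : ℝ) / 8) ≤ μ.real (CurveClass.rangeSubset (closure D'.carrier)) := by
    intro j
    obtain ⟨J, N, Φ, hJ, h0J, hΦ, hdj, hN, hNJ, hK⟩ := hdata j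
    obtain ⟨D', Ψ', hD', hΨ', hΨ'd, hdisj⟩ :=
      exists_hullSubdomain_collar hφ h hJ h0J hΦ hdj hN hNJ hK hKim
    refine ⟨D', hdisj, ?_⟩
    exact (ENNReal.ofReal_le_iff_le_toReal (measure_ne_top _ _)).1
      (H D' φ Ψ' (d j) hD' hφ hΨ' hΨ'd)
  choose D' hdisj hlim using key
  refine ⟨fun j ↦ (D' j).carrier, fun j ↦ d j ^ ((5 : ℝ) / 8), ?_, hdisj, hlim⟩
  have := hd.rpow_const (p := (5 : ℝ) / 8) (Or.inl one_ne_zero)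
  rwa [Real.one_rpow] at this

/-- **Collars from the upper sandwich** (port of `FloorRatio.stub_chordalCarrier_collars`): every
boundary piece `frontierPiece D k` is covered by the two compact arcs `ψ[r, R]`, `ψ[-R, -r]` of a
chordal uniformizing map, each avoided by the closures of a sequence of subdomains `Ω'_j` with
`p_j ≤ μ{trace ⊆ cl Ω'_j}`, `p_j → 1` (half-ellipse hulls, `Φ'(0) → 1`).
[cite: LawlerSchrammWerner2003Restriction, §2 p. 8, Lemma 3.2 and Thm. 6.1 (transposed)] -/
theorem collars_of_upper [IsFiniteMeasure μ]
    (H : ∀ (D' : DobrushinDomain) (φ : ConformalEquiv upperHalfPlaneSet D.carrier)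
      (Φ : ConformalEquiv (upperHalfPlaneSet \ φ.pullbackHull D') upperHalfPlaneSet) (d : ℝ),
      D.IsHullSubdomain D' → D.IsChordalUniformizing φ →
      IsRestrictionMap (φ.pullbackHull D') Φ → HasRestrictionDeriv (φ.pullbackHull D') Φ d →
      ENNReal.ofReal (d ^ ((5 : ℝ) / 8)) ≤ μ (CurveClass.rangeSubset (closure D'.carrier)))
    (k : ℕ) :
    ∃ Z₁ Z₂ : Set ℂ, IsClosed Z₁ ∧ IsClosed Z₂ ∧
      frontierPiece D k ⊆ Z₁ ∪ Z₂ ∧ ∀ Z ∈ ({Z₁, Z₂} : Set (Set ℂ)),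
        ∃ (Ω' : ℕ → Set ℂ) (p : ℕ → ℝ), Tendsto p atTop (𝓝 1) ∧
          (∀ j, Disjoint (closure (Ω' j)) Z) ∧
          ∀ j, p j ≤ μ.real (CurveClass.rangeSubset (closure (Ω' j))) := by
  obtain ⟨φ, hφ⟩ := MarkedDomain.exists_isChordalUniformizing_holds D
  obtain ⟨Ψ, h⟩ := JordanDomain.exists_isDiscExtension JordanDomain.exists_continuousOn_extension_holds φ
  obtain ⟨r, R, hr, hrR, hcov⟩ := exists_Icc_cover_frontierPiece h hφ k
  have hreal : ∀ u v : ℝ, (fun x : ℝ ↦ (x : ℂ)) '' Icc u v ⊆ closure upperHalfPlaneSet := by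
    rintro u v _ ⟨x, -, rfl⟩
    exact mem_closure_upperHalfPlaneSet_iff.2 (by simp)
  have him : ∀ u v : ℝ, ∀ z ∈ (fun x : ℝ ↦ (x : ℂ)) '' Icc u v, 0 ≤ z.im := by
    rintro u v _ ⟨x, -, rfl⟩; simp
  have hclosed : ∀ u v : ℝ,
      IsClosed (φ.boundaryExtension '' ((fun x : ℝ ↦ (x : ℂ)) '' Icc u v)) := fun u v ↦
    (MarkedDomain.isCompact_image_boundaryExtension JordanDomain.exists_continuousOn_extension_holds
      (hreal u v) (isCompact_Icc.image continuous_ofReal)).isClosed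
  obtain ⟨d, hd, hdata⟩ := exists_plusData hr hrR
  refine ⟨_, _, hclosed r R, hclosed (-R) (-r), hcov, ?_⟩
  rintro Z hZ
  simp only [mem_insert_iff, mem_singleton_iff] at hZ
  rcases hZ with rfl | rfl
  · exact exists_collarFamily_of_upper hφ h H (him r R) hd hdata
  · refine exists_collarFamily_of_upper hφ h H (him (-R) (-r)) hd fun j ↦ ?_
    rw [← imagAxisRefl_image_ofReal_Icc r R]
    exact reflect_data (hdata j)

/-- **The chordal carrier from the upper sandwich.**  A probability law on curve classes which is
a.e. simple, a.e. runs from `a` to `b`, a.e. has trace in `cl D`, and satisfies the upper half of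
the restriction sandwich `Φ'_A(0)^{5/8} ≤ μ{trace ⊆ cl D'}` over the hull subdomains `D'` of
`(D; a, b)`, is carried by `chordalCarrier D`: the trace misses every boundary piece by the collar
families (`collars_of_upper`, `ae_disjoint_range_of_upper`), hence meets `∂D` only in `{a, b}`.
[cite: LawlerSchrammWerner2003Restriction, Lemma 3.2 and Thm. 6.1 (transposed sandwich)] -/
theorem ae_mem_chordalCarrier_of_upper [IsProbabilityMeasure μ]
    (hsimple : ∀ᵐ c ∂μ, c ∈ CurveClass.simple)
    (hends : ∀ᵐ c ∂μ, c.source = D.pt 0 ∧ c.target = D.pt 1)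
    (hconf : ∀ᵐ c ∂μ, c.range ⊆ closure D.carrier)
    (H : ∀ (D' : DobrushinDomain) (φ : ConformalEquiv upperHalfPlaneSet D.carrier)
      (Φ : ConformalEquiv (upperHalfPlaneSet \ φ.pullbackHull D') upperHalfPlaneSet) (d : ℝ),
      D.IsHullSubdomain D' → D.IsChordalUniformizing φ →
      IsRestrictionMap (φ.pullbackHull D') Φ → HasRestrictionDeriv (φ.pullbackHull D') Φ d →
      ENNReal.ofReal (d ^ ((5 : ℝ) / 8)) ≤ μ (CurveClass.rangeSubset (closure D'.carrier))) :
    ∀ᵐ c ∂μ, c ∈ chordalCarrier D := by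
  have hpiece : ∀ k : ℕ, ∀ᵐ c ∂μ, Disjoint c.range (frontierPiece D k) := by
    intro k
    obtain ⟨Z₁, Z₂, hZ₁, hZ₂, hcov, hZ⟩ := collars_of_upper H k
    obtain ⟨Ω₁, p₁, hp₁, hd₁, hl₁⟩ := hZ Z₁ (by simp)
    obtain ⟨Ω₂, p₂, hp₂, hd₂, hl₂⟩ := hZ Z₂ (by simp)
    filter_upwards [ae_disjoint_range_of_upper hZ₁ hl₁ hp₁ hd₁,
      ae_disjoint_range_of_upper hZ₂ hl₂ hp₂ hd₂] with c h1 h2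
    exact Set.disjoint_of_subset_right hcov (h1.union_right h2)
  filter_upwards [hsimple, hends, hconf, ae_all_iff.2 hpiece] with c h1 h2 h4 h5
  refine ⟨⟨⟨h1, h2.1⟩, h2.2⟩, ?_⟩
  show c ∈ {c : CurveClass ℂ | c.range ⊆ D.carrier ∪ {D.pt 0, D.pt 1}}
  rw [setOf_range_subset_eq]
  exact ⟨h4, mem_iInter.2 fun k ↦ (h5 k).subset_compl_right⟩

end Carrier

/-! ### Registry forms -/

/-- **Registered sub-goal `stub_twoPieceAdmIdentification_closing`** (crux item
stmt-CriticalPhenomena-14005, line `bridge-gate-renewal`, stub `stub_twoPieceAdmIdentification`):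
registry form of `isSLELaw_of_carrier_of_sandwich` — a probability law carried by the chordal
carrier and satisfying the restriction sandwich over all hull subdomains is the SLE(8/3) law.
[cite: LawlerSchrammWerner2003Restriction, Lemma 3.2 (p. 10), Lemma 2.1 (p. 8), Thm. 6.1 (p. 23), §8.1 (p. 31), transposed] -/
theorem stub_twoPieceAdmIdentification_closing :
    ∀ (D : DobrushinDomain) (μ : Measure (CurveClass ℂ)), IsProbabilityMeasure μ →
      (∀ᵐ c ∂μ, c ∈ chordalCarrier D) →
      (∀ (D' : DobrushinDomain) (φ : ConformalEquiv upperHalfPlaneSet D.carrier)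
        (Φ : ConformalEquiv (upperHalfPlaneSet \ φ.pullbackHull D') upperHalfPlaneSet) (d : ℝ),
        D.IsHullSubdomain D' → D.IsChordalUniformizing φ →
        IsRestrictionMap (φ.pullbackHull D') Φ → HasRestrictionDeriv (φ.pullbackHull D') Φ d →
        μ (CurveClass.rangeSubset (φ.boundaryExtension '' φ.pullbackHull D')ᶜ) ≤
            ENNReal.ofReal (d ^ ((5 : ℝ) / 8)) ∧
          ENNReal.ofReal (d ^ ((5 : ℝ) / 8)) ≤ μ (CurveClass.rangeSubset (closure D'.carrier))) →
      IsSLELaw ((8 : ℝ≥0) / 3) D μ :=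
  fun D μ hμ hcar hsand => by
    haveI := hμ
    exact isSLELaw_of_carrier_of_sandwich hcar hsand

/-- **Registered sub-goal `stub_twoPieceAdmIdentification_carrier`** (crux item
stmt-CriticalPhenomena-14005, line `bridge-gate-renewal`, stub `stub_twoPieceAdmIdentification`):
registry form of `ae_mem_chordalCarrier_of_upper`.
[cite: LawlerSchrammWerner2003Restriction, Lemma 3.2 and Thm. 6.1 (transposed sandwich)] -/
theorem stub_twoPieceAdmIdentification_carrier :
    ∀ (D : DobrushinDomain) (μ : Measure (CurveClass ℂ)), IsProbabilityMeasure μ →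
      (∀ᵐ c ∂μ, c ∈ CurveClass.simple) →
      (∀ᵐ c ∂μ, c.source = D.pt 0 ∧ c.target = D.pt 1) →
      (∀ᵐ c ∂μ, c.range ⊆ closure D.carrier) →
      (∀ (D' : DobrushinDomain) (φ : ConformalEquiv upperHalfPlaneSet D.carrier)
        (Φ : ConformalEquiv (upperHalfPlaneSet \ φ.pullbackHull D') upperHalfPlaneSet) (d : ℝ),
        D.IsHullSubdomain D' → D.IsChordalUniformizing φ →
        IsRestrictionMap (φ.pullbackHull D') Φ → HasRestrictionDeriv (φ.pullbackHull D') Φ d →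
        ENNReal.ofReal (d ^ ((5 : ℝ) / 8)) ≤ μ (CurveClass.rangeSubset (closure D'.carrier))) →
      ∀ᵐ c ∂μ, c ∈ chordalCarrier D :=
  fun D μ hμ hsimple hends hconf H => by
    haveI := hμ
    exact ae_mem_chordalCarrier_of_upper hsimple hends hconf H

end Summit.CriticalPhenomena.SAWScalingLimit.Theorems.ObservableToSLER.TwoPiece

end
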